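import Mathlib

/-!
# SoloBlind kernel #134 — the block-triangular (lift-up) inverse bound

Abstract form of the transverse-sector estimate (P⁺)(ii) of the solo-blind programme
(paper §24.86–24.87): the steady linearised operator of a transverse perturbation of the
columnar pattern is LOWER BLOCK-TRIANGULAR, `(x, y) ↦ (A x, B x + C y)` — `A` the
Orr–Sommerfeld/Stokes block on the normal velocity, `C` the Squire/Stokes block on the
normal vorticity, `B` the lift-up coupling `-i β U'`.  If `A` and `C` are invertible with
`‖A⁻¹‖ ≤ a`, `‖C⁻¹‖ ≤ c` and `‖B‖ ≤ b`, every `(x, y)` obeys the two-sided bound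
`‖(x, y)‖ ≤ (a + c (1 + b a)) ‖(A x, B x + C y)‖` (sup norm on the product), and the
triangular system is solvable for every right-hand side.  With Stokes blocks
`a = c = S ≤ Re` and shear `b = k` this is the loss law `Λ ≤ 2 + k·Re` of the tables
(paper 24.87(4), transverse sector, up to the constant).  The last lemma is the order count
of the closing step (E_{N₀}): `N₀ = ⌊6γ⌋` orders of the `n^{-1/3}` hierarchy suffice for a
polynomial loss `Re_p^γ`.
-/

namespace Summit.AnomalousDissipation.AnomalousDissipation.Theorems

open ContinuousLinearMap

section Triangular

variable {𝕜 : Type*} [NontriviallyNormedField 𝕜]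
  {E F : Type*} [NormedAddCommGroup E] [NormedSpace 𝕜 E]
  [NormedAddCommGroup F] [NormedSpace 𝕜 F]

/-- Two-sided (lower) bound for a lower block-triangular operator `(x, y) ↦ (A x, B x + C y)`
with invertible diagonal blocks: `‖(x, y)‖ ≤ (a + c (1 + b a)) · ‖(A x, B x + C y)‖`
whenever `‖A⁻¹‖ ≤ a`, `‖C⁻¹‖ ≤ c`, `‖B‖ ≤ b` (product = sup norm). -/
theorem triangular_lower_bound (A : E ≃L[𝕜] E) (C : F ≃L[𝕜] F) (B : E →L[𝕜] F)
    {a b c : ℝ} (ha : ‖(A.symm : E →L[𝕜] E)‖ ≤ a) (hc : ‖(C.symm : F →L[𝕜] F)‖ ≤ c)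
    (hb : ‖B‖ ≤ b) (x : E) (y : F) :
    ‖(x, y)‖ ≤ (a + c * (1 + b * a)) * ‖(A x, B x + C y)‖ := by
  set P := ‖(A x, B x + C y)‖ with hP
  have hP0 : 0 ≤ P := norm_nonneg _
  have ha0 : 0 ≤ a := le_trans (norm_nonneg _) ha
  have hb0 : 0 ≤ b := le_trans (norm_nonneg _) hb
  have hc0 : 0 ≤ c := le_trans (norm_nonneg _) hc
  have h1 : ‖A x‖ ≤ P := norm_fst_le (A x, B x + C y)
  have h2 : ‖B x + C y‖ ≤ P := norm_snd_le (A x, B x + C y)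
  have hx : ‖x‖ ≤ a * P := by
    have hxe : x = (A.symm : E →L[𝕜] E) (A x) := by simp
    calc ‖x‖ = ‖(A.symm : E →L[𝕜] E) (A x)‖ := by rw [← hxe]
      _ ≤ ‖(A.symm : E →L[𝕜] E)‖ * ‖A x‖ := le_opNorm _ _
      _ ≤ a * P := mul_le_mul ha h1 (norm_nonneg _) ha0
  have hy : ‖y‖ ≤ c * (1 + b * a) * P := by
    have hye : y = (C.symm : F →L[𝕜] F) ((B x + C y) - B x) := by simp
    calc ‖y‖ = ‖(C.symm : F →L[𝕜] F) ((B x + C y) - B x)‖ := by rw [← hye]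
      _ ≤ ‖(C.symm : F →L[𝕜] F)‖ * ‖(B x + C y) - B x‖ := le_opNorm _ _
      _ ≤ c * (P + b * (a * P)) := by
          apply mul_le_mul hc _ (norm_nonneg _) hc0
          calc ‖(B x + C y) - B x‖ ≤ ‖B x + C y‖ + ‖B x‖ := norm_sub_le _ _
            _ ≤ P + ‖B‖ * ‖x‖ := add_le_add h2 (B.le_opNorm x)
            _ ≤ P + b * (a * P) := by
                have := mul_le_mul hb hx (norm_nonneg _) hb0
                linarith
      _ = c * (1 + b * a) * P := by ring
  have hcP : 0 ≤ c * (1 + b * a) * P := by positivity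
  have haP : 0 ≤ a * P := by positivity
  calc ‖(x, y)‖ = max ‖x‖ ‖y‖ := rfl
    _ ≤ (a + c * (1 + b * a)) * P := by
        apply max_le
        · linarith
        · linarith

/-- The lower block-triangular system `A x = x'`, `B x + C y = y'` is solvable for every
right-hand side when the diagonal blocks are invertible (explicit back-substitution). -/
theorem triangular_solvable (A : E ≃L[𝕜] E) (C : F ≃L[𝕜] F) (B : E →L[𝕜] F)
    (x' : E) (y' : F) : ∃ x : E, ∃ y : F, A x = x' ∧ B x + C y = y' :=
  ⟨A.symm x', C.symm (y' - B (A.symm x')), by simp, by simp⟩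

/-- Combined form: every right-hand side has a solution obeying the triangular bound. -/
theorem triangular_inverse_bound (A : E ≃L[𝕜] E) (C : F ≃L[𝕜] F) (B : E →L[𝕜] F)
    {a b c : ℝ} (ha : ‖(A.symm : E →L[𝕜] E)‖ ≤ a) (hc : ‖(C.symm : F →L[𝕜] F)‖ ≤ c)
    (hb : ‖B‖ ≤ b) (x' : E) (y' : F) :
    ∃ x : E, ∃ y : F, A x = x' ∧ B x + C y = y' ∧
      ‖(x, y)‖ ≤ (a + c * (1 + b * a)) * ‖(x', y')‖ := by
  obtain ⟨x, y, h1, h2⟩ := triangular_solvable A C B x' y'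
  refine ⟨x, y, h1, h2, ?_⟩
  have := triangular_lower_bound A C B ha hc hb x y
  rw [h1, h2] at this
  exact this

end Triangular

/-- The transverse loss law in numbers: Stokes blocks with `‖A⁻¹‖, ‖C⁻¹‖ ≤ S ≤ Re` and
shear coupling `‖B‖ ≤ k` give the constant `S + S (1 + k S) ≤ Re (2 + k Re)`, i.e. a loss
`Λ ≤ 2 + k·Re` relative to one Stokes inverse (paper 24.87(4): measured `Λ = .043·k·Re`). -/
theorem transverse_loss_le (S k Re : ℝ) (hS : 0 ≤ S) (hk : 0 ≤ k) (hRe : S ≤ Re) :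
    S + S * (1 + k * S) ≤ Re * (2 + k * Re) := by
  have hRe0 : 0 ≤ Re := le_trans hS hRe
  have h1 : k * S ≤ k * Re := mul_le_mul_of_nonneg_left hRe hk
  have h2 : S * (1 + k * S) ≤ Re * (1 + k * Re) := by
    apply mul_le_mul hRe (by linarith) (by positivity) hRe0
  linarith

/-- Order count of the closing step (E_{N₀}): a polynomial loss `Re_p^γ ≍ n^γ` of the full
steady inverse is beaten by the residual of the `n^{-1/3}` hierarchy carried to order
`N₀ = ⌊6γ⌋`, since `(N₀ + 1)/3 > 2γ`. -/
theorem orders_needed (γ : ℝ) : 2 * γ < ((⌊6 * γ⌋₊ : ℝ) + 1) / 3 := by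
  have h := Nat.lt_floor_add_one (6 * γ)
  linarith

/-- … and `⌊6γ⌋` is the least such order when `6γ` is an integer `m ≥ 1`
(e.g. `γ = 1 ⇒ N₀ = 6`, `γ = 1/2 ⇒ N₀ = 3`): order `m - 1` does not suffice. -/
theorem orders_needed_sharp (m : ℕ) (hm : 1 ≤ m) :
    ¬ (2 * ((m : ℝ) / 6) < (((m - 1 : ℕ) : ℝ) + 1) / 3) := by
  have hcast : (((m - 1 : ℕ) : ℝ)) = (m : ℝ) - 1 := by
    rw [Nat.cast_sub hm]; simp
  rw [hcast]
  intro h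
  linarith

end Summit.AnomalousDissipation.AnomalousDissipation.Theorems
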